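import Summits.ValiantsHypothesis.ValiantsHypothesis.Theorems.LacunarySymmetroidMatrixDescartesCensusV19CSoundTerms
import Summits.ValiantsHypothesis.ValiantsHypothesis.Theorems.LacunarySymmetroidMatrixDescartesCensusCaseCKit

/-!
# `MatrixDescartes` census — soundness of the CASE-C checker: every row the checker builds holds in a model (AM–GM of any size, `one`/`amgm`/`link`/`C25` rows)

HONEST FRAMING.  Object-search cell `pub-symmetroid`; door-A item `DoorA26 = PosRootLawAt 2 6 19`
(stmt-ValiantsHypothesis-19979; OPEN, typed, never asserted).  Part of the proof that certificates accepted by `V19C.checkSupport` (`…CensusV19CCheck`)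
exclude a nineteen on a one-collision support (semantics: `…CensusV19CModel`).  Abstract layer, continued: rows.  Nothing here bears on the
`2`-Sidon supports, on `ζ_sym(2,6)` over all supports, on `DoorA26` itself, on `MatrixDescartes` (stmt-ValiantsHypothesis-18050) or on `VP ≠ VNP`.

[folklore] Certificate-checker soundness; elementary.
-/

-- the D-0017 layout repeats a namespace component (single-conjunct summit); the `dupNamespace` linter flags it; name mandated.
set_option linter.dupNamespace false

namespace Summit.ValiantsHypothesis.ValiantsHypothesis.Theorems.LacunarySymmetroidMatrixDescartes.Census.V19C

open V20 (Atom allAtoms psum posOf qA cA Term PolySpec posl oddTrues FNat fval Row rowC25 rowOne rowAmgm FRat negAt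
  G3poly RCSpoly Wpoly tval pval lprod xpow frval BPos lprod_pos lprod_cons lprod_append lprod_replicate lprod_flatten atoms_valid
  coeff_ne_zero qA_mem cA_mem term_getD_mem pval_eq_sum_range fval_nil fval_cons fval_singleton fval_append fval_map_one fval_pos
  dist1_pos)

section Rows

open Finset

variable {c : Ctx} {x : ℕ → ℝ} {v : Atom → ℝ}

/-- AM–GM for a list of non-negative reals: `m^m ∏ aⱼ ≤ (∑ aⱼ)^m`. [folklore] -/
theorem amgm_list (L : List ℝ) (hL : ∀ a ∈ L, 0 ≤ a) : (L.length : ℝ) ^ L.length * L.prod ≤ L.sum ^ L.length := by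
  have key := card_pow_mul_prod_le_pow_of_sum_le (Finset.univ : Finset (Fin L.length)) (fun i => L[i.1])
    (fun i _ => hL _ (List.getElem_mem i.2)) (t := L.sum) (by rw [Fin.sum_univ_getElem])
  rw [Finset.card_univ, Fintype.card_fin, Fin.prod_univ_getElem] at key
  exact key

/-- `posIndex` returns the unique non-zero positive term of a valid inequality (and, for `RCS`, a definite first letter). [folklore] -/
theorem posIndex_spec {P : PolySpec} {p : ℕ} (h : posIndex c P = some p) :
    P.valid = true ∧ posTerms c P.poly = [p] ∧ (∀ i j, P = .rcs i j → atomPos c (qA i) = true) := by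
  unfold posIndex at h
  split_ifs at h with hc
  rw [Bool.and_eq_true] at hc
  refine ⟨hc.1, ?_, ?_⟩
  · split at h
    · next q heq => cases h; exact heq
    · cases h
  · intro i j hP
    subst hP
    simpa [defOK] using hc.2

/-- The named inequality holds in the model (for `RCS` given a definite first letter). [folklore] -/
theorem pval_nonneg (M : Model c x v) (P : PolySpec) (hP : P.valid = true)
    (hdef : ∀ i j, P = .rcs i j → atomPos c (qA i) = true) : 0 ≤ pval v P.poly := by
  cases P with
  | g3 i j k =>
    simp only [PolySpec.valid, decide_eq_true_eq] at hP
    exact M.g3 i j k hP.1 hP.2.1 hP.2.2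
  | rcs i j =>
    simp only [PolySpec.valid, decide_eq_true_eq] at hP
    have hq : 0 < v (qA i) := M.v_pos (qA_mem hP.1) (hdef i j rfl)
    exact M.rcs i j hP.1 hP.2.1 hP.2.2 hq
  | w i j k l =>
    simp only [PolySpec.valid, decide_eq_true_eq] at hP
    obtain ⟨hi, hj, hk, hl, h1, h2, h3, h4, h5, h6⟩ := hP
    exact M.w i j k l hi hj hk hl h1 h2 h3 h4 h5 h6

/-- The positive index is an index. [folklore] -/
theorem lt_length_of_posTerms_eq {P : List Term} {p : ℕ} (hpos : posTerms c P = [p]) : p < P.length :=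
  lt_length_of_mem_posTerms (c := c) (by rw [hpos]; simp)

/-- The single-positive row `|tₙ| ≤ t_p` holds (term `n` without the zero atom). [folklore] -/
theorem rowOne_holds (M : Model c x v) {P : PolySpec} {p n : ℕ} (hp : posIndex c P = some p)
    (hn : n < P.poly.length) (hnp : n ≠ p) (hz : termZero c (P.poly.getD n (0, [])) = false) :
    (rowOne c.ordS P.poly p n).Holds x := by
  obtain ⟨hval, hpos, hdef⟩ := posIndex_spec hp
  have hP := pval_nonneg M P hval hdef
  obtain ⟨hsum, -⟩ := sum_abs_le_pos M P hval hpos hP [n] (by simpa using ⟨hn, hnp⟩) (List.nodup_singleton n)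
  simp only [List.map_cons, List.map_nil, List.sum_cons, List.sum_nil, add_zero] at hsum
  have hpl := lt_length_of_posTerms_eq hpos
  have hTn := atoms_valid P hval _ (term_getD_mem P.poly hn)
  have hTp := atoms_valid P hval _ (term_getD_mem P.poly hpl)
  rw [abs_tval_eq M _ hTn hz] at hsum
  have hpm := (mem_posTerms_iff (c := c) hpl).1 (by rw [hpos]; simp)
  rw [tval_eq_of_not_termNeg M _ hTp hpm.1 hpm.2] at hsum
  unfold Row.Holds rowOne
  simp only [fval_singleton, pow_one, Nat.cast_natAbs, Int.cast_abs]
  linarith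

/-- The AM–GM row holds (terms of `S` without the zero atom). [folklore] -/
theorem rowAmgm_holds (M : Model c x v) {P : PolySpec} {p : ℕ} (hp : posIndex c P = some p)
    (S : List ℕ) (hS : ∀ j ∈ S, j < P.poly.length ∧ j ≠ p) (hSz : ∀ j ∈ S, termZero c (P.poly.getD j (0, [])) = false)
    (hSnd : S.Nodup) : (rowAmgm c.ordS P.poly p S).Holds x := by
  obtain ⟨hval, hpos, hdef⟩ := posIndex_spec hp
  have hP := pval_nonneg M P hval hdef
  obtain ⟨hsum, hp0⟩ := sum_abs_le_pos M P hval hpos hP S hS hSnd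
  have hpl := lt_length_of_posTerms_eq hpos
  have hTp := atoms_valid P hval _ (term_getD_mem P.poly hpl)
  have hpm := (mem_posTerms_iff (c := c) hpl).1 (by rw [hpos]; simp)
  -- abbreviations: `g j` = |coefficient|, `m j` = monomial of slot magnitudes
  set g : ℕ → ℝ := fun j => |((P.poly.getD j (0, [])).1 : ℝ)| with hg
  set m : ℕ → ℝ := fun j => lprod x (posl c.ordS (P.poly.getD j (0, [])).2) with hm
  have habs : (S.map fun j => |tval v (P.poly.getD j (0, []))|) = S.map fun j => g j * m j := by
    refine List.map_congr_left fun j hj => ?_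
    exact abs_tval_eq M _ (atoms_valid P hval _ (term_getD_mem P.poly (hS j hj).1)) (hSz j hj)
  rw [habs] at hsum
  have htp : tval v (P.poly.getD p (0, [])) = g p * m p := tval_eq_of_not_termNeg M _ hTp hpm.1 hpm.2
  rw [htp] at hsum hp0
  -- AM–GM on the list `a_j = g j * m j`
  set A : List ℝ := S.map fun j => g j * m j with hA
  have hAnn : ∀ a ∈ A, 0 ≤ a := by
    intro a ha; rw [hA, List.mem_map] at ha; obtain ⟨j, -, rfl⟩ := ha
    exact mul_nonneg (abs_nonneg _) (lprod_pos M.xpos _).le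
  have hAlen : A.length = S.length := by simp [hA]
  have hmain := amgm_list A hAnn
  rw [hAlen] at hmain
  have hstep : (S.length : ℝ) ^ S.length * A.prod ≤ (g p * m p) ^ S.length :=
    hmain.trans (pow_le_pow_left₀ (List.sum_nonneg hAnn) hsum _)
  have hAprod : A.prod = (S.map g).prod * (S.map m).prod := by rw [hA, List.prod_map_mul]
  have hL : lprod x (rowAmgm c.ordS P.poly p S).L = (S.map m).prod := by
    show lprod x (S.map fun j => posl c.ordS (P.poly.getD j (0, [])).2).flatten = (S.map m).prod
    rw [lprod_flatten, List.map_map]; rfl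
  have hR : lprod x (rowAmgm c.ordS P.poly p S).R = m p ^ S.length := by
    show lprod x (List.replicate S.length (posl c.ordS (P.poly.getD p (0, [])).2)).flatten = m p ^ S.length
    rw [lprod_flatten, List.map_replicate, List.prod_replicate]
  have hBden : (fval (rowAmgm c.ordS P.poly p S).Bden : ℝ) = (S.length : ℝ) ^ S.length * (S.map g).prod := by
    show (fval ((S.length, S.length) :: S.map fun j => ((fun i => (P.poly.getD i (0, [])).1.natAbs) j, 1)) : ℝ)
      = (S.length : ℝ) ^ S.length * (S.map g).prod
    rw [fval_cons, Nat.cast_mul, Nat.cast_pow, fval_map_one]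
    congr 1
    exact congrArg List.prod (List.map_congr_left fun j _ => by rw [Nat.cast_natAbs, Int.cast_abs])
  have hBnum : (fval (rowAmgm c.ordS P.poly p S).Bnum : ℝ) = g p ^ S.length := by
    show (fval [((P.poly.getD p (0, [])).1.natAbs, S.length)] : ℝ) = g p ^ S.length
    rw [fval_singleton]; push_cast; rw [Nat.cast_natAbs, Int.cast_abs]
  unfold Row.Holds
  rw [hL, hR, hBden, hBnum]
  calc (S.map m).prod * ((S.length : ℝ) ^ S.length * (S.map g).prod)
      = (S.length : ℝ) ^ S.length * A.prod := by rw [hAprod]; ring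
    _ ≤ (g p * m p) ^ S.length := hstep
    _ = m p ^ S.length * g p ^ S.length := by ring

/-- A licensed LINK row has factor `1` or `2`. [folklore] -/
theorem factor_of_linkOK {br : Br} {sm lg : LinkVar} {f : ℕ} (h : linkOK br sm f lg = true) : f = 1 ∨ f = 2 := by
  cases br <;> cases sm <;> cases lg <;> simp [linkOK] at h <;> omega

/-- Slots of link variables are `< 22`. [folklore] -/
theorem LinkVar.slot_lt {pstar : ℕ} (h : pstar < 20) (u : LinkVar) : u.slot pstar < 22 := by
  cases u <;> simp only [LinkVar.slot] <;> omega

/-- Every row the checker builds holds in the model and is well formed. [folklore] -/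
theorem buildRow_sound (M : Model c x v) {rs : RowSpec} {r : Row} (h : buildRow c rs = some r) : r.Holds x ∧ RowWF r := by
  cases rs with
  | c25 t =>
    simp only [buildRow] at h
    split_ifs at h with ht
    cases h
    refine ⟨M.c25 t ht.1 ht.2, ?_, ?_, ?_, ?_⟩
    · intro p hp
      simp only [rowC25, List.mem_append, List.mem_replicate] at hp
      omega
    · intro p hp
      simp only [rowC25, List.mem_replicate] at hp
      omega
    · intro be hbe
      simp only [rowC25, List.mem_map] at hbe
      obtain ⟨u, -, rfl⟩ := hbe
      exact dist1_pos _ _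
    · intro be hbe
      simp only [rowC25, List.mem_append, List.mem_map] at hbe
      rcases hbe with ⟨u, -, rfl⟩ | ⟨u, -, rfl⟩ <;> exact dist1_pos _ _
  | link sm f lg =>
    simp only [buildRow] at h
    split_ifs at h with hl
    cases h
    refine ⟨M.link sm f lg hl, ?_, ?_, ?_, ?_⟩
    · intro p hp
      simp only [rowLink, List.mem_singleton] at hp
      subst hp; exact LinkVar.slot_lt M.wf.pstar_lt _
    · intro p hp
      simp only [rowLink, List.mem_singleton] at hp
      subst hp; exact LinkVar.slot_lt M.wf.pstar_lt _
    · intro be hbe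
      simp only [rowLink, List.mem_singleton] at hbe
      subst hbe
      rcases factor_of_linkOK hl with e | e <;> simp [e]
    · intro be hbe
      simp [rowLink] at hbe
  | one P n =>
    simp only [buildRow] at h
    split at h
    · next p hp =>
      split_ifs at h with hn
      cases h
      simp only [Bool.and_eq_true, decide_eq_true_eq, Bool.not_eq_true'] at hn
      obtain ⟨⟨hn1, hn2⟩, hz⟩ := hn
      obtain ⟨hval, hpos, -⟩ := posIndex_spec hp
      have hpl := lt_length_of_posTerms_eq hpos
      refine ⟨rowOne_holds M hp hn1 hn2 hz, ?_, ?_, ?_, ?_⟩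
      · exact posl_lt_22 M (atoms_valid P hval _ (term_getD_mem P.poly hn1))
      · exact posl_lt_22 M (atoms_valid P hval _ (term_getD_mem P.poly hpl))
      · intro be hbe
        simp only [rowOne, List.mem_singleton] at hbe
        subst hbe
        exact Int.natAbs_pos.2 (coeff_ne_zero P _ (term_getD_mem P.poly hpl))
      · intro be hbe
        simp only [rowOne, List.mem_singleton] at hbe
        subst hbe
        exact Int.natAbs_pos.2 (coeff_ne_zero P _ (term_getD_mem P.poly hn1))
    · cases h
  | amgm P S =>
    simp only [buildRow] at h
    split at h
    · next p hp =>
      split_ifs at h with hc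
      cases h
      simp only [Bool.and_eq_true, decide_eq_true_eq, List.all_eq_true, Bool.not_eq_true'] at hc
      obtain ⟨⟨⟨hS, hSz⟩, hSnd⟩, hSne⟩ := hc
      obtain ⟨hval, hpos, -⟩ := posIndex_spec hp
      have hpl := lt_length_of_posTerms_eq hpos
      refine ⟨rowAmgm_holds M hp S hS hSz hSnd, ?_, ?_, ?_, ?_⟩
      · intro q hq
        simp only [rowAmgm, List.mem_flatten, List.mem_map] at hq
        obtain ⟨l, ⟨j, hj, rfl⟩, hq⟩ := hq
        exact posl_lt_22 M (atoms_valid P hval _ (term_getD_mem P.poly (hS j hj).1)) q hq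
      · intro q hq
        simp only [rowAmgm, List.mem_flatten, List.mem_replicate] at hq
        obtain ⟨l, ⟨-, rfl⟩, hq⟩ := hq
        exact posl_lt_22 M (atoms_valid P hval _ (term_getD_mem P.poly hpl)) q hq
      · intro be hbe
        simp only [rowAmgm, List.mem_singleton] at hbe
        subst hbe
        exact Int.natAbs_pos.2 (coeff_ne_zero P _ (term_getD_mem P.poly hpl))
      · intro be hbe
        simp only [rowAmgm, List.mem_cons, List.mem_map] at hbe
        rcases hbe with rfl | ⟨j, hj, rfl⟩
        · exact List.length_pos_iff.2 hSne
        · exact Int.natAbs_pos.2 (coeff_ne_zero P _ (term_getD_mem P.poly (hS j hj).1))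
    · cases h

end Rows

end Summit.ValiantsHypothesis.ValiantsHypothesis.Theorems.LacunarySymmetroidMatrixDescartes.Census.V19C
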